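import Summits.Schanuel.Schanuel.Theorems.ZilberEacStripRoot
import HarnessLib

/-!
# Logarithmic strips, II: zeros of `Σ_j q_j(z) e^{e_j(αz+β)} + E(z)` next to a sequence of
# degree-one corrected roots (engine v4)

HONEST FRAMING.  Cell `pub-schanuel` (Zilber's Exponential-Algebraic Closedness, case ladder;
host summit Schanuel), seat 2, gen 17.  Degree-one companion of engine v3
(`exists_escape_zeros_log`): given corrected roots `z₀(k)`, `L(k)` with `e^{L} = z₀`,
`e^{αz₀+β} = θ e^{μL}`, `‖z₀(k)‖ → ∞` (supplied by `exists_lineRoot_log_seq`), polynomial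
coefficients `q_j`, exponents `e_j`, a slope/height `(μ, κ)` with `deg q_j + μe_j ≤ κ` whose top
polynomial `Q_μ` is nonzero with the root `θ ≠ 0`, and an entire `E` with
`‖E(z₀(k) + u/α)‖ ≤ η‖e^{κL(k)}‖` eventually for every `η > 0` (`‖u‖ ≤ 1`), the functions
`g(z) = Σ_j q_j(z)e^{e_j(αz+β)} + E(z)` have, for all large `k`, a zero `z₀(k) + u/α` with
`‖u‖ < min(ε, ‖α‖)` (any `0 < ε ≤ 1`) (exact local coordinate: `α(z₀ + u/α) + β = (αz₀ + β) + u`; normaliser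
`e^{κL}`; Hurwitz persistence).  Consumers: fibre curves `P(x₀, y₀) = 0` over graph bases
(`E = 0`, `α = 1`; `ZilberEacGraphSurfaceFibreCurve`).  NOT Schanuel's conjecture (neither used nor
implied; EAC ⇏ SC); `EC(3,2)` stays OPEN; Mantova–Masser's density question stays OPEN in general.
-/

noncomputable section

open Filter Topology Metric Set Complex Polynomial
open Literature.ModelTheory.Zilber

set_option linter.dupNamespace false

namespace Summit.Schanuel.Schanuel.Theorems

/-- **Engine v4: zeros next to degree-one corrected roots.**  See the module docstring. (new) -/
theorem exists_strip_zeros {ι : Type*} (α β : ℂ) (hα : α ≠ 0)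
    (J : Finset ι) (q : ι → Polynomial ℂ) (e : ι → ℕ) (μ κ : ℝ)
    (hκ : ∀ j ∈ J, ((q j).natDegree : ℝ) + μ * e j ≤ κ)
    {θ : ℂ} (hθ0 : θ ≠ 0)
    (hθ : (∑ j ∈ J.filter (fun j => ((q j).natDegree : ℝ) + μ * e j = κ),
        Polynomial.C (q j).leadingCoeff * Polynomial.X ^ (e j)).eval θ = 0)
    (hQ : (∑ j ∈ J.filter (fun j => ((q j).natDegree : ℝ) + μ * e j = κ),
        Polynomial.C (q j).leadingCoeff * Polynomial.X ^ (e j)) ≠ 0)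
    (z₀ Lg : ℕ → ℂ) (hLz : ∀ k, exp (Lg k) = z₀ k)
    (hz₀θ : ∀ k, exp (α * z₀ k + β) = θ * exp ((μ : ℂ) * Lg k))
    (hz₀norm : Tendsto (fun k => ‖z₀ k‖) atTop atTop)
    (E : ℂ → ℂ) (hE : Differentiable ℂ E)
    (hEs : ∀ η : ℝ, 0 < η → ∀ᶠ k in atTop, ∀ u ∈ closedBall (0 : ℂ) 1,
      ‖E (z₀ k + u / α)‖ ≤ η * ‖exp ((κ : ℂ) * Lg k)‖) {ε : ℝ} (hε0 : 0 < ε) (hε1 : ε ≤ 1) :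
    ∀ᶠ k in atTop, ∃ u ∈ ball (0 : ℂ) (min ε ‖α‖),
      (∑ j ∈ J, (q j).eval (z₀ k + u / α) * exp (α * (z₀ k + u / α) + β) ^ (e j)) +
        E (z₀ k + u / α) = 0 := by
  classical
  set Jt := J.filter (fun j => ((q j).natDegree : ℝ) + μ * e j = κ) with hJt
  set Jn := J.filter (fun j => ¬ ((q j).natDegree : ℝ) + μ * e j = κ) with hJn
  set Qμ : Polynomial ℂ := ∑ j ∈ Jt, Polynomial.C (q j).leadingCoeff * Polynomial.X ^ (e j)
    with hQμ
  have hαpos : 0 < ‖α‖ := norm_pos_iff.2 hα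
  have hε : 0 < min ε ‖α‖ := lt_min hε0 hαpos
  -- the limit function `h(u) = Q_μ(θ e^u)`
  set h : ℂ → ℂ := fun u => Qμ.eval (θ * exp u) with hh_def
  have hh : Differentiable ℂ h :=
    (Polynomial.differentiable Qμ).comp ((differentiable_const θ).mul differentiable_exp)
  have hh0 : h 0 = 0 := by simp only [hh_def, Complex.exp_zero, mul_one]; exact hθ
  have hhne : ∃ u, h u ≠ 0 := exists_eval_mul_exp_ne_zero hQ hθ0
  -- the roots are eventually large
  have hReL : ∀ j, (Lg j).re = Real.log ‖z₀ j‖ := fun j => re_eq_log_norm_of_exp_eq (hLz j)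
  have hev1 : ∀ᶠ k in atTop, 1 ≤ ‖z₀ k‖ := hz₀norm.eventually_ge_atTop 1
  have hlog : Tendsto (fun j => Real.log ‖z₀ j‖) atTop atTop :=
    Real.tendsto_log_atTop.comp hz₀norm
  -- coefficient ratios
  set Kq : ι → ℝ := fun j =>
    (coeffNormSum (q j) + coeffNormSum (q j).eraseLead +
      (q j).natDegree * ‖(q j).leadingCoeff‖) * 2 ^ (q j).natDegree with hKq
  have hKq0 : ∀ j, 0 ≤ Kq j := fun j => by
    have := coeffNormSum_nonneg (q j); have := coeffNormSum_nonneg (q j).eraseLead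
    simp only [hKq]; positivity
  have hdisp : ∀ k (u : ℂ), ‖u‖ ≤ min ε ‖α‖ → ‖(z₀ k + u / α) - z₀ k‖ ≤ 1 := by
    intro k u hu
    rw [add_sub_cancel_left, norm_div, div_le_one hαpos]
    exact hu.trans (min_le_right _ _)
  have hratio : ∀ j k (u : ℂ), ‖u‖ ≤ min ε ‖α‖ → 1 ≤ ‖z₀ k‖ →
      ‖(q j).eval (z₀ k + u / α) / z₀ k ^ (q j).natDegree - (q j).leadingCoeff‖ ≤ Kq j / ‖z₀ k‖ :=
    fun j k u hu hk => norm_eval_div_pow_sub_coeff_le (q j) le_rfl hk (hdisp k u hu)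
  -- normalisers and weights
  set D : ℕ → ℂ := fun i => exp ((κ : ℂ) * Lg i) with hD_def
  have hD0 : ∀ i, D i ≠ 0 := fun i => Complex.exp_ne_zero _
  set F : ℕ → ι → ℂ := fun i j =>
    exp (((((q j).natDegree : ℝ) + μ * e j - κ : ℝ) : ℂ) * Lg i) with hF_def
  have hFtop : ∀ i, ∀ j ∈ Jt, F i j = 1 := by
    intro i j hj
    obtain ⟨_, hjt⟩ := Finset.mem_filter.1 hj
    have h0 : ((q j).natDegree : ℝ) + μ * e j - κ = 0 := by linarith
    simp only [hF_def, h0]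
    simp
  have hFnorm : ∀ i j, ‖F i j‖ =
      Real.exp ((((q j).natDegree : ℝ) + μ * e j - κ) * Real.log ‖z₀ i‖) := by
    intro i j
    simp only [hF_def]
    rw [Complex.norm_exp, Complex.re_ofReal_mul, hReL]
  have hFmul : ∀ i j, z₀ i ^ (q j).natDegree * exp ((μ : ℂ) * Lg i) ^ (e j) = F i j * D i := by
    intro i j
    simp only [hF_def, hD_def]
    rw [← hLz i, ← Complex.exp_nat_mul, ← Complex.exp_nat_mul, ← Complex.exp_add,
      ← Complex.exp_add]
    congr 1
    push_cast
    ring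
  -- the rescaled functions
  set g : ℂ → ℂ := fun z => (∑ j ∈ J, (q j).eval z * exp (α * z + β) ^ (e j)) + E z with hg_def
  set G : ℕ → ℂ → ℂ := fun i u => g (z₀ i + u / α) / D i with hG_def
  have hgdiff : Differentiable ℂ g := by
    refine (Differentiable.fun_sum fun j _ => ?_).add hE
    exact (Polynomial.differentiable _).mul
      ((((differentiable_const α).mul differentiable_id).add (differentiable_const β)).cexp.pow _)
  have hGdiff : ∀ i, Differentiable ℂ (G i) := by
    intro i
    have hφ : Differentiable ℂ (fun u : ℂ => z₀ i + u / α) :=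
      (differentiable_const _).add (differentiable_id.div_const _)
    exact (hgdiff.comp hφ).div_const _
  -- the key identity (exact): `e^{α(z₀ + u/α) + β} = θ e^{μL} e^{u}`
  have hkey : ∀ i (u : ℂ), exp (α * (z₀ i + u / α) + β) = θ * exp ((μ : ℂ) * Lg i) * exp u := by
    intro i u
    rw [← hz₀θ i, ← Complex.exp_add]
    congr 1
    field_simp
    ring
  set W : ℝ := ‖θ‖ * Real.exp 1 with hW
  -- uniform approximation on `closedBall 0 (min ε ‖α‖)`
  have hunif : ∀ η : ℝ, 0 < η → ∀ᶠ i in atTop, ∀ u ∈ closedBall (0 : ℂ) (min ε ‖α‖),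
      ‖G i u - h u‖ < η := by
    intro η hη
    have hη3 : 0 < η / 3 := by positivity
    have hevT : ∀ᶠ i in atTop, (∑ j ∈ Jt, Kq j * W ^ (e j)) / ‖z₀ i‖ < η / 3 :=
      (tendsto_const_nhds.div_atTop hz₀norm).eventually (gt_mem_nhds hη3)
    have hevN : ∀ᶠ i in atTop, ∑ j ∈ Jn, (‖(q j).leadingCoeff‖ + Kq j) *
        Real.exp ((((q j).natDegree : ℝ) + μ * e j - κ) * Real.log ‖z₀ i‖) * W ^ (e j) <
          η / 3 := by
      have hlim : Tendsto (fun i => ∑ j ∈ Jn, (‖(q j).leadingCoeff‖ + Kq j) *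
          Real.exp ((((q j).natDegree : ℝ) + μ * e j - κ) * Real.log ‖z₀ i‖) * W ^ (e j))
          atTop (𝓝 0) := by
        rw [show (0 : ℝ) = ∑ j ∈ Jn, 0 by simp]
        refine tendsto_finsetSum _ fun j hj => ?_
        obtain ⟨hjJ, hjn⟩ := Finset.mem_filter.1 hj
        have hγ : ((q j).natDegree : ℝ) + μ * e j - κ < 0 := by
          rcases (hκ j hjJ).lt_or_eq with hlt | heq
          · linarith
          · exact absurd heq hjn
        have h1 : Tendsto (fun i => Real.exp ((((q j).natDegree : ℝ) + μ * e j - κ) *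
            Real.log ‖z₀ i‖)) atTop (𝓝 0) :=
          Real.tendsto_exp_atBot.comp (hlog.const_mul_atTop_of_neg hγ)
        have h2 := (h1.const_mul (‖(q j).leadingCoeff‖ + Kq j)).mul_const (W ^ (e j))
        simpa using h2
      exact hlim.eventually (gt_mem_nhds hη3)
    have hevE := hEs (η / 3) hη3
    filter_upwards [hevT, hevN, hevE, hev1] with i hiT hiN hiE hi1 u hu
    rw [mem_closedBall, dist_zero_right] at hu
    have hu1 : ‖u‖ ≤ 1 := (hu.trans (min_le_left _ _)).trans hε1
    have huB : u ∈ closedBall (0 : ℂ) 1 := by rw [mem_closedBall, dist_zero_right]; exact hu1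
    have hw : ‖θ * exp u‖ ≤ W := by
      rw [norm_mul, Complex.norm_exp, hW]
      refine mul_le_mul_of_nonneg_left (Real.exp_le_exp.2 ?_) (norm_nonneg _)
      exact (re_le_norm u).trans hu1
    -- (1) top coefficient tails
    have hTterm : ‖∑ j ∈ Jt, ((q j).eval (z₀ i + u / α) / z₀ i ^ (q j).natDegree -
        (q j).leadingCoeff) * (θ * exp u) ^ (e j)‖ < η / 3 := by
      refine lt_of_le_of_lt ?_ hiT
      rw [Finset.sum_div]
      refine (norm_sum_le _ _).trans (Finset.sum_le_sum fun j _ => ?_)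
      rw [norm_mul, norm_pow]
      calc ‖(q j).eval (z₀ i + u / α) / z₀ i ^ (q j).natDegree - (q j).leadingCoeff‖ *
            ‖θ * exp u‖ ^ (e j)
          ≤ Kq j / ‖z₀ i‖ * W ^ (e j) :=
            mul_le_mul (hratio j i u hu hi1) (pow_le_pow_left₀ (norm_nonneg _) hw (e j))
              (by positivity) (div_nonneg (hKq0 j) (norm_nonneg _))
        _ = Kq j * W ^ (e j) / ‖z₀ i‖ := by ring
    -- (2) non-top terms
    have hNterm : ‖∑ j ∈ Jn, (q j).eval (z₀ i + u / α) / z₀ i ^ (q j).natDegree * F i j *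
        (θ * exp u) ^ (e j)‖ < η / 3 := by
      refine lt_of_le_of_lt ?_ hiN
      refine (norm_sum_le _ _).trans (Finset.sum_le_sum fun j _ => ?_)
      rw [norm_mul, norm_mul, norm_pow, hFnorm]
      have hr : ‖(q j).eval (z₀ i + u / α) / z₀ i ^ (q j).natDegree‖ ≤
          ‖(q j).leadingCoeff‖ + Kq j := by
        have h1 := hratio j i u hu hi1
        have h2 := norm_le_insert' ((q j).eval (z₀ i + u / α) / z₀ i ^ (q j).natDegree)
          (q j).leadingCoeff
        have h3 : Kq j / ‖z₀ i‖ ≤ Kq j := div_le_self (hKq0 j) hi1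
        linarith
      have hWpow : ‖θ * exp u‖ ^ (e j) ≤ W ^ (e j) := pow_le_pow_left₀ (norm_nonneg _) hw (e j)
      have hlc0 : 0 ≤ ‖(q j).leadingCoeff‖ + Kq j := by have := hKq0 j; positivity
      exact mul_le_mul (mul_le_mul_of_nonneg_right hr (Real.exp_nonneg _)) hWpow
        (by positivity) (by positivity)
    -- (3) the `E`-term
    have hEterm : ‖E (z₀ i + u / α) / D i‖ ≤ η / 3 := by
      have hDpos : 0 < ‖D i‖ := norm_pos_iff.2 (hD0 i)
      rw [norm_div, div_le_iff₀ hDpos]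
      exact hiE u huB
    -- assemble
    have hterm : ∀ j ∈ J, (q j).eval (z₀ i + u / α) * exp (α * (z₀ i + u / α) + β) ^ (e j) / D i =
        (q j).eval (z₀ i + u / α) / z₀ i ^ (q j).natDegree * F i j * (θ * exp u) ^ (e j) := by
      intro j _
      have hzn : z₀ i ^ (q j).natDegree ≠ 0 :=
        pow_ne_zero _ (norm_pos_iff.1 (by linarith))
      have e1 : (q j).eval (z₀ i + u / α) = (q j).eval (z₀ i + u / α) / z₀ i ^ (q j).natDegree *
          z₀ i ^ (q j).natDegree := (div_mul_cancel₀ _ hzn).symm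
      rw [hkey i u]
      conv_lhs => rw [e1]
      calc (q j).eval (z₀ i + u / α) / z₀ i ^ (q j).natDegree * z₀ i ^ (q j).natDegree *
            (θ * exp ((μ : ℂ) * Lg i) * exp u) ^ (e j) / D i
          = (q j).eval (z₀ i + u / α) / z₀ i ^ (q j).natDegree *
              (z₀ i ^ (q j).natDegree * exp ((μ : ℂ) * Lg i) ^ (e j)) *
              (θ * exp u) ^ (e j) / D i := by ring
        _ = (q j).eval (z₀ i + u / α) / z₀ i ^ (q j).natDegree * (F i j * D i) *
              (θ * exp u) ^ (e j) / D i := by rw [hFmul i j]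
        _ = (q j).eval (z₀ i + u / α) / z₀ i ^ (q j).natDegree * F i j *
              (θ * exp u) ^ (e j) * D i / D i := by ring
        _ = (q j).eval (z₀ i + u / α) / z₀ i ^ (q j).natDegree * F i j *
              (θ * exp u) ^ (e j) := mul_div_cancel_right₀ _ (hD0 i)
    have hGsplit : G i u - h u =
        (∑ j ∈ Jt, ((q j).eval (z₀ i + u / α) / z₀ i ^ (q j).natDegree - (q j).leadingCoeff) *
          (θ * exp u) ^ (e j)) +
        (∑ j ∈ Jn, (q j).eval (z₀ i + u / α) / z₀ i ^ (q j).natDegree * F i j *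
          (θ * exp u) ^ (e j)) +
        E (z₀ i + u / α) / D i := by
      have hQμe : h u = ∑ j ∈ Jt, (q j).leadingCoeff * (θ * exp u) ^ (e j) := by
        simp only [hh_def]
        rw [hQμ, Polynomial.eval_finsetSum]
        refine Finset.sum_congr rfl fun j _ => ?_
        rw [Polynomial.eval_mul, Polynomial.eval_C, Polynomial.eval_pow, Polynomial.eval_X]
      have hsum : (∑ j ∈ J, (q j).eval (z₀ i + u / α) * exp (α * (z₀ i + u / α) + β) ^ (e j)) /
          D i =
          (∑ j ∈ Jt, (q j).eval (z₀ i + u / α) / z₀ i ^ (q j).natDegree * (θ * exp u) ^ (e j)) +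
          ∑ j ∈ Jn, (q j).eval (z₀ i + u / α) / z₀ i ^ (q j).natDegree * F i j *
            (θ * exp u) ^ (e j) := by
        rw [Finset.sum_div, Finset.sum_congr rfl hterm,
          ← Finset.sum_filter_add_sum_filter_not J
            (fun j => ((q j).natDegree : ℝ) + μ * e j = κ)]
        congr 1
        refine Finset.sum_congr rfl fun j hj => ?_
        rw [hFtop i j hj, mul_one]
      have htails : ∑ j ∈ Jt, (q j).eval (z₀ i + u / α) / z₀ i ^ (q j).natDegree *
          (θ * exp u) ^ (e j) =
          (∑ j ∈ Jt, ((q j).eval (z₀ i + u / α) / z₀ i ^ (q j).natDegree - (q j).leadingCoeff) *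
            (θ * exp u) ^ (e j)) +
          ∑ j ∈ Jt, (q j).leadingCoeff * (θ * exp u) ^ (e j) := by
        rw [← Finset.sum_add_distrib]
        refine Finset.sum_congr rfl fun j _ => ?_
        ring
      rw [hG_def, hg_def, hQμe]
      simp only []
      rw [add_div, hsum, htails]
      ring
    rw [hGsplit]
    calc ‖(∑ j ∈ Jt, ((q j).eval (z₀ i + u / α) / z₀ i ^ (q j).natDegree - (q j).leadingCoeff) *
            (θ * exp u) ^ (e j)) +
          (∑ j ∈ Jn, (q j).eval (z₀ i + u / α) / z₀ i ^ (q j).natDegree * F i j *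
            (θ * exp u) ^ (e j)) +
          E (z₀ i + u / α) / D i‖
        ≤ ‖∑ j ∈ Jt, ((q j).eval (z₀ i + u / α) / z₀ i ^ (q j).natDegree - (q j).leadingCoeff) *
            (θ * exp u) ^ (e j)‖ +
          ‖∑ j ∈ Jn, (q j).eval (z₀ i + u / α) / z₀ i ^ (q j).natDegree * F i j *
            (θ * exp u) ^ (e j)‖ +
          ‖E (z₀ i + u / α) / D i‖ := norm_add₃_le
      _ < η / 3 + η / 3 + η / 3 := by linarith
      _ = η := by ring
  -- persistence
  have hzeros := eventually_exists_zero_of_unif_approx hh hhne hh0 hGdiff hε hunif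
  filter_upwards [hzeros] with k hk
  obtain ⟨u, hu, hu0⟩ := hk
  refine ⟨u, hu, ?_⟩
  have : g (z₀ k + u / α) = 0 := by
    rw [hG_def] at hu0
    exact (div_eq_zero_iff.1 hu0).resolve_right (hD0 _)
  simpa [hg_def] using this

end Summit.Schanuel.Schanuel.Theorems
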